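import Summits.ValiantsHypothesis.ValiantsHypothesis.Theorems.RigidityForcesSymmetryRankRigidMinimalReprLaplaceResidualCaseOneKernel

/-!
# Case 1 of the `a = 3` residual blueprint: the REDUCTION — inside any codimension-`2` subspace some `φ₂` makes the
# two-slot bilinear form NON-proportional to a prescribed matrix (crux `RankRigidMinimalRepr`, stmt-18034; rung `LaplaceOptimalFive`, stmt-24813)

FILE 2c of the `a = 3` residual blueprint (val-lit-p8 g11, `NOTE-p8g11-24813-a3-class-residual4.md` §v3 «REDUCTION»;
val-lit desk RULING #258 (a); seat val-port-2; successor memo `HOME/lmr/NOTE-port2-24813-a3-residual-bricks.md` (R1)).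
With `F(x,y) = Σ_{σ 3 = x, σ 4 = y} φ₀(σ0) φ₁(σ1) φ₂(σ2)` the bilinear form of `LaplaceResidual.permanent_two_slot`:

* **`exists_orthogonal_not_proportional`** — KERNEL-LINE form (interface agreed with val-lit-p3 g14 so that Case 1 and
  Case 2 feed the same lemma): if every `φ₂` killing the two-slot form (`F(x,y) = 0`, `x ≠ y`) lies on a line `ℂ·w`, then
  for ANY two covectors `γ, μ` and ANY array `N` there is `φ₂` with `Σ φ₂ γ = 0`, `Σ φ₂ μ = 0` and `F(φ₀,φ₁,φ₂) ∉ ℂ·N`.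
  Proof = the blueprint's dimension count: `V = ker γ ∩ ker μ` has `finrank ≥ 3` (rank–nullity in `ℂ⁵`); if every
  `φ₂ ∈ V` gave `F ∈ ℂ·N`, the linear map `φ₂ ↦ F` would send `V` into the line `ℂ·N`, so its kernel in `V` would have
  `finrank ≥ 2` — but it sits inside `ℂ·w`, `finrank ≤ 1`.
* `exists_orthogonal_not_proportional_of_fullSupport` — Case 1: `φ₀` of full support and `φ₁ a ≠ 0` give the kernel
  line by `fibreSum_kernel_on_line` (FILE 2b).
Use (memo (R2)): `γ` = the slice vector of slot 2, `μ` = the slot-2 charge of the pair `{0,2}` given `φ₀`, `N` = the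
`u`-table of the pair `{3,4}` (type A3) or the `φ₀`-contracted `w`-table of the pair `{1,2}` (type A2); then LEMMA C
(`bilinear_proportional`) yields `(φ₃, φ₄)` killing the last pair with `per ≠ 0`, and `refute_of_kills` closes Case 1.
No definitions.  HONEST FRAMING: a linear-algebra helper; `hres` is NOT discharged here; 24813/24814/18034 stay OPEN;
nothing here bears on `VP ≠ VNP`. [folklore]
-/

set_option autoImplicit false

-- the mandated summit-side namespace repeats a component by design (single-problem summit)
set_option linter.dupNamespace false

namespace Summit.ValiantsHypothesis.ValiantsHypothesis.Theorems.RigidityForcesSymmetryRankRigidMinimalRepr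

namespace LaplaceResidual

open Finset Module

/-- **REDUCTION (Case 1).**  For `φ₀` of full support and `φ₁ a ≠ 0`, every codimension-`≤ 2` subspace
`{φ₂ : Σ φ₂ γ = 0, Σ φ₂ μ = 0}` contains a `φ₂` whose two-slot bilinear form `F(φ₀,φ₁,φ₂)` is NOT a multiple of the
prescribed array `N`. [folklore] -/
theorem exists_orthogonal_not_proportional (φ₀ φ₁ : Fin 5 → ℂ) (w : Fin 5 → ℂ)
    (hline : ∀ φ₂ : Fin 5 → ℂ,
      (∀ x y : Fin 5, x ≠ y →
        (∑ τ : Equiv.Perm (Fin 5),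
          if τ 3 = x ∧ τ 4 = y then φ₀ (τ 0) * φ₁ (τ 1) * φ₂ (τ 2) else 0) = 0) →
      ∃ κ : ℂ, ∀ c, φ₂ c = κ * w c)
    (γ μ : Fin 5 → ℂ) (N : Fin 5 → Fin 5 → ℂ) :
    ∃ φ₂ : Fin 5 → ℂ, (∑ c, φ₂ c * γ c) = 0 ∧ (∑ c, φ₂ c * μ c) = 0 ∧
      ¬ ∃ κ : ℂ, ∀ x y : Fin 5,
        (∑ τ : Equiv.Perm (Fin 5),
          if τ 3 = x ∧ τ 4 = y then φ₀ (τ 0) * φ₁ (τ 1) * φ₂ (τ 2) else 0) = κ * N x y := by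
  classical
  by_contra hcon
  push Not at hcon
  -- the two constraints as a linear map to `ℂ²`
  let L : (Fin 5 → ℂ) →ₗ[ℂ] (Fin 2 → ℂ) :=
    { toFun := fun φ₂ => ![∑ c, φ₂ c * γ c, ∑ c, φ₂ c * μ c]
      map_add' := fun f g => by
        ext i; fin_cases i <;> simp [add_mul, Finset.sum_add_distrib]
      map_smul' := fun r f => by
        ext i; fin_cases i <;> simp [mul_assoc, Finset.mul_sum] }
  -- the two-slot bilinear form as a linear map of `φ₂`
  let Φ : (Fin 5 → ℂ) →ₗ[ℂ] (Fin 5 → Fin 5 → ℂ) :=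
    { toFun := fun φ₂ x y => ∑ τ : Equiv.Perm (Fin 5),
        (if τ 3 = x ∧ τ 4 = y then φ₀ (τ 0) * φ₁ (τ 1) else 0) * φ₂ (τ 2)
      map_add' := fun f g => by
        ext x y; simp only [Pi.add_apply, mul_add, Finset.sum_add_distrib]
      map_smul' := fun r f => by
        ext x y
        simp only [Pi.smul_apply, smul_eq_mul, RingHom.id_apply, Finset.mul_sum]
        exact Finset.sum_congr rfl fun τ _ => by ring }
  have hΦ : ∀ (φ₂ : Fin 5 → ℂ) (x y : Fin 5), Φ φ₂ x y =
      ∑ τ : Equiv.Perm (Fin 5), if τ 3 = x ∧ τ 4 = y then φ₀ (τ 0) * φ₁ (τ 1) * φ₂ (τ 2) else 0 := by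
    intro φ₂ x y
    show (∑ τ : Equiv.Perm (Fin 5), (if τ 3 = x ∧ τ 4 = y then φ₀ (τ 0) * φ₁ (τ 1) else 0) * φ₂ (τ 2)) = _
    refine Finset.sum_congr rfl fun τ _ => ?_
    simp only [ite_mul, zero_mul]
  -- `V = ker L` has `finrank ≥ 3`
  set V : Submodule ℂ (Fin 5 → ℂ) := LinearMap.ker L with hV
  have hV3 : 3 ≤ finrank ℂ V := by
    have h1 := LinearMap.finrank_range_add_finrank_ker L
    have h2 : finrank ℂ (LinearMap.range L) ≤ 2 :=
      (Submodule.finrank_le _).trans (by rw [finrank_fin_fun])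
    rw [finrank_fin_fun] at h1
    rw [hV]
    omega
  -- the restriction `Ψ` of `Φ` to `V` ranges inside the line `ℂ·N`
  let Ψ : V →ₗ[ℂ] (Fin 5 → Fin 5 → ℂ) := Φ.comp V.subtype
  have hmemV : ∀ φ₂ : Fin 5 → ℂ, φ₂ ∈ V ↔ (∑ c, φ₂ c * γ c) = 0 ∧ (∑ c, φ₂ c * μ c) = 0 := by
    intro φ₂
    rw [hV, LinearMap.mem_ker]
    constructor
    · intro h
      have h0' := congr_fun h 0
      have h1' := congr_fun h 1
      simp only [L, LinearMap.coe_mk, AddHom.coe_mk, Matrix.cons_val_zero, Matrix.cons_val_one,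
        Pi.zero_apply] at h0' h1'
      exact ⟨h0', h1'⟩
    · rintro ⟨hγ, hμ⟩
      ext i; fin_cases i <;> simp [L, hγ, hμ]
  have hrange : LinearMap.range Ψ ≤ LinearMap.range (LinearMap.toSpanSingleton ℂ (Fin 5 → Fin 5 → ℂ) N) := by
    rintro _ ⟨⟨φ₂, hφ₂⟩, rfl⟩
    obtain ⟨hγ, hμ⟩ := (hmemV φ₂).1 hφ₂
    obtain ⟨κ, hκ⟩ := hcon φ₂ hγ hμ
    refine ⟨κ, ?_⟩
    ext x y
    simp only [LinearMap.toSpanSingleton_apply, Pi.smul_apply, smul_eq_mul, Ψ, LinearMap.comp_apply,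
      Submodule.subtype_apply, hΦ, hκ x y]
  have hr1 : finrank ℂ (LinearMap.range Ψ) ≤ 1 := by
    calc finrank ℂ (LinearMap.range Ψ)
        ≤ finrank ℂ (LinearMap.range (LinearMap.toSpanSingleton ℂ (Fin 5 → Fin 5 → ℂ) N)) :=
          Submodule.finrank_mono hrange
      _ ≤ finrank ℂ ℂ := LinearMap.finrank_range_le _
      _ = 1 := finrank_self ℂ
  -- the kernel of `Ψ` sits inside the line `ℂ·w` (hypothesis `hline`)
  let ι : (LinearMap.ker Ψ) →ₗ[ℂ] (Fin 5 → ℂ) := V.subtype.comp (LinearMap.ker Ψ).subtype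
  have hι : Function.Injective ι := fun p q h => Subtype.ext (Subtype.ext h)
  have hιrange : LinearMap.range ι ≤ LinearMap.range (LinearMap.toSpanSingleton ℂ (Fin 5 → ℂ) w) := by
    rintro _ ⟨r, rfl⟩
    have hr : Ψ (r : V) = 0 := (LinearMap.mem_ker).1 r.2
    obtain ⟨κ, hκ⟩ := hline ((r : V) : Fin 5 → ℂ) (fun x y _ => by
      have := congr_fun (congr_fun hr x) y
      simpa only [Ψ, LinearMap.comp_apply, Submodule.subtype_apply, hΦ, Pi.zero_apply] using this)
    refine ⟨κ, ?_⟩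
    funext c
    simp only [LinearMap.toSpanSingleton_apply, Pi.smul_apply, smul_eq_mul, ι, LinearMap.comp_apply,
      Submodule.subtype_apply, hκ c]
  have hk1 : finrank ℂ (LinearMap.ker Ψ) ≤ 1 := by
    calc finrank ℂ (LinearMap.ker Ψ) = finrank ℂ (LinearMap.range ι) := (LinearMap.finrank_range_of_inj hι).symm
      _ ≤ finrank ℂ (LinearMap.range (LinearMap.toSpanSingleton ℂ (Fin 5 → ℂ) w)) :=
          Submodule.finrank_mono hιrange
      _ ≤ finrank ℂ ℂ := LinearMap.finrank_range_le _
      _ = 1 := finrank_self ℂ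
  -- rank–nullity for `Ψ` contradicts `finrank V ≥ 3`
  have hrn := LinearMap.finrank_range_add_finrank_ker Ψ
  omega

/-- **REDUCTION, Case 1** (`φ₀` of full support, `φ₁ a ≠ 0`): the kernel-line hypothesis is `fibreSum_kernel_on_line`
(FILE 2b), so inside any `{Σ φ₂ γ = 0, Σ φ₂ μ = 0}` some `φ₂` has two-slot form `F(φ₀,φ₁,φ₂) ∉ ℂ·N`. [folklore] -/
theorem exists_orthogonal_not_proportional_of_fullSupport (φ₀ φ₁ : Fin 5 → ℂ) (h0 : ∀ c, φ₀ c ≠ 0) (a : Fin 5)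
    (ha : φ₁ a ≠ 0) (γ μ : Fin 5 → ℂ) (N : Fin 5 → Fin 5 → ℂ) :
    ∃ φ₂ : Fin 5 → ℂ, (∑ c, φ₂ c * γ c) = 0 ∧ (∑ c, φ₂ c * μ c) = 0 ∧
      ¬ ∃ κ : ℂ, ∀ x y : Fin 5,
        (∑ τ : Equiv.Perm (Fin 5),
          if τ 3 = x ∧ τ 4 = y then φ₀ (τ 0) * φ₁ (τ 1) * φ₂ (τ 2) else 0) = κ * N x y :=
  exists_orthogonal_not_proportional φ₀ φ₁ (fun y => if y = a then 1 else -(φ₁ y / φ₁ a))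
    (fun φ₂ hF => ⟨φ₂ a, fibreSum_kernel_on_line (![φ₀, φ₁, φ₂, 0, 0]) h0 a ha hF⟩) γ μ N

end LaplaceResidual

end Summit.ValiantsHypothesis.ValiantsHypothesis.Theorems.RigidityForcesSymmetryRankRigidMinimalRepr
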